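import Summits.AtomisticToContinuum.BoseEinsteinCondensation.Theses.BECRewardDescent
import Summits.AtomisticToContinuum.BoseEinsteinCondensation.Theorems.BECRewardDescentWalkGlueCurve
import Summits.AtomisticToContinuum.BoseEinsteinCondensation.Theorems.BECRewardDescentRewardChordBoundNoKinkOfSimple
import Summits.AtomisticToContinuum.BoseEinsteinCondensation.Theorems.BECRewardDescentRewardChordBoundModulusOfSimple
import Summits.AtomisticToContinuum.BoseEinsteinCondensation.Theorems.BECRewardDescentRewardChordBoundChordFromModulus
import Summits.AtomisticToContinuum.BoseEinsteinCondensation.Theorems.BECRewardDescentRewardScaleChord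
import Summits.AtomisticToContinuum.BoseEinsteinCondensation.Theorems.BECRewardDescentRewardChordBoundKyFanGapIntegrable
import Summits.AtomisticToContinuum.BoseEinsteinCondensation.Theorems.BECRewardDescentRewardChordBoundZeroMomentumIntegrable
import Summits.AtomisticToContinuum.BoseEinsteinCondensation.Theorems.BECConjugateDominationHardCoreExtensionMaxFormApproximationFiniteRange
import Literature.MathematicalPhysics.QuantumManyBody.PeriodicSlotDepletion
import Literature.MathematicalPhysics.QuantumManyBody.PeriodicMaxFormTranslation
import Literature.MathematicalPhysics.QuantumManyBody.TorusSlotShiftDirichlet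
import Literature.Analysis.FunctionSpaces.TorusPairDist
import Summits.AtomisticToContinuum.BoseEinsteinCondensation.Theorems.BECRewardDescentRewardChordBoundSimpleOfPositiveOn
import Summits.AtomisticToContinuum.BoseEinsteinCondensation.Theorems.BECRewardDescentRewardChordBoundFreeRegionSpreading
import Summits.AtomisticToContinuum.BoseEinsteinCondensation.Theorems.BECRewardDescentRewardChordBoundRewardedClassFR
import Summits.AtomisticToContinuum.BoseEinsteinCondensation.Theorems.BECRewardDescentRewardChordBoundInvariantApproximationFR
import Summits.AtomisticToContinuum.BoseEinsteinCondensation.Theorems.BECRewardDescentRewardChordBoundTeleportDescent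
import Summits.AtomisticToContinuum.BoseEinsteinCondensation.Theorems.BECRewardDescentRewardChordBoundSimpleNonintegrable
import Summits.AtomisticToContinuum.BoseEinsteinCondensation.Theorems.BECRewardDescentRewardChordBoundSecantWalk

/-!
# Crux `RewardChordBound` (stmt-AtomisticToContinuum-12876) — line `registered` (= `Lines/birth.lean`),
# lead's RESHAPED skeleton (7 stubs, same composition idea as the birth skeleton)

Route `route-AtomisticToContinuum-BECRewardDescent` (sub-problem `BoseEinsteinCondensation`), crux decl
`Summit.AtomisticToContinuum.BoseEinsteinCondensation.Theses.BECRewardDescent.RewardChordBound` (RUNG 2 = the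
walk): for every repulsive finite-range `v` and `τ > 0` there are `θ, ρ₀ > 0` such that at density `ρ < ρ₀`,
eventually in `N`, for all rewards `0 < s ≤ s₀ := θρa`, `R(s) + (s/s₀)E₀ ≤ E₀ + (s/s₀)R(s₀) + sτN` for the reward
infimum `R(t) = inf_Ψ ⟨Ψ,HΨ⟩ + t(N − ⟨Ψ,n̂₀Ψ⟩)` (secant slopes: `chord(s) ≤ chord(s₀) + τN`, i.e. `∫₀^{s₀} χ ≤ τN`).

## The line (birth: `χ ≤ 2Var(n̂₀)/Δ_(P=0)` integrated from `s₀ = θρa` down to `0⁺` along a condensation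
bootstrap) and the lead's reshape

The birth skeleton typed the finite-volume glue as two stubs, `stub_noLevelCrossing` (no kink of `R` at any
`s > 0`) and `stub_concavityModulus` (`2R(s) − R(s+h) − R(s−h) ≤ 2h²V/(g − 2hN)` from the `P = 0` Ky-Fan gap and
the variance bound). Both silently contain the Perron–Frobenius fact "the ground state of `H + s·n̂₊` is simple
and has zero total momentum" (the diagnosis left on the glue item stmt-12880 by its prover: the walk controls
`R = inf` over ALL trial states while `SectorGap` speaks of translation-invariant pairs only, and the docstring
reduction "global inf = zero-momentum inf via `|Ψ|` and its translation average" is not a variational argument —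
the Rayleigh quotient of a translation average is not controlled by that of `|Ψ|`). The reshape isolates that
content as ONE stub in Ky-Fan (vector-free) vocabulary and makes the two analytic steps purely variational:

* stub 1 `stub_rewardScaleChord : RewardScaleChord` (route crux 12877, BY NAME) — rung 1 at `s₀` with `η/4`;
* stub 2 `stub_sectorGap : SectorGap` (route crux 12874, BY NAME) — `P = 0` Ky-Fan gap `c√(ρa s)` (condensed);
* stub 3 `stub_condensateVariance : CondensateVariance` (route crux 12875, BY NAME) — `Var n̂₀ ≤ CN` (condensed);
* stub 4 `stub_rewardedGroundStateSimple` (NEW, the Perron–Frobenius input, finite volume at low density):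
  eventually in `N`, for every `s > 0` with `R(s) < ∞`: (i) a strict Ky-Fan gap of `F_s` over ALL `L²`-orthogonal
  pairs of periodic trial states (simplicity of the rewarded ground state) and (ii) translation-invariant
  near-minimisers of `F_s` at every precision (zero momentum of the rewarded ground state);
* stub 5 `stub_noKinkOfSimple` (NEW, variational, provable now): (i) at `s` ⇒ `R` has no kink at `s`
  (clustering of near-minimisers from a Ky-Fan gap by the parallelogram law, `L²`-Lipschitz continuity of the
  bounded quadratic form `n̂₀`, and `F_{s±h} = F_s ± h·dep`);
* stub 6 `stub_modulusOfSimple` (NEW, variational, provable now): (ii) on `[s−h, s+h]`, the translation-invariant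
  Ky-Fan gap `g` at `s` (the body of `SectorGap`) and the variance bound `V` at `s` (the body of
  `CondensateVariance`) ⇒ `2R(s) ≤ R(s+h) + R(s−h) + 2h²V/(g − 2hN)` (2×2 Temple/Feshbach lower bound around an
  invariant near-minimiser `Ψ` of `F_s`: for invariant `Φ = αΨ + βχ`, `χ ⊥ Ψ`,
  `F_{s±h}(Φ) ≥ R ± h·dep(Ψ) + |β|²(g − hN) − 2h|β|√V − o_δ(1)`, minimised in `|β|`; the `±h·dep(Ψ)` cancel);
* stub 7 `stub_chordFromModulus` (the walk proper, real analysis, provable now from the landed WalkGlue helpers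
  `chord_le_chord_add_of_sqrt_budget`, `concaveOn_toReal_iInf_affine`, `ennreal_chord_of_real_chord`, Griffiths'
  near-minimiser lemmas): verbatim the birth stub except that its modulus hypothesis is asked only for `h < s`
  (the bootstrap uses `h → 0⁺`), so that stub 6 needs zero momentum only at rewards `t ≥ s − h > 0`;
* `RewardChordBound_of : RewardChordBound` (crux decl BY NAME, the seven stubs BY NAME, no `sorry` of its own):
  `η := min η₁ η₂`, `θ := θ(η,c,C,τ)` (stub 7), `ρ₀ := min ρ₁ … ρ₅` (stubs 2, 3, 1, `PeriodicEnergyFinite_holds`,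
  stub 4), intersection of the five eventual sets, finiteness of every `R(t)` from `E₀ < ∞`
  (`WalkGlue.iInf_affine_ne_top`), then stub 7 fed with rung 1 at `s₀`, stub 5 ← stub 4(i), and stub 6 ← stub
  4(ii) + `SectorGap` + `CondensateVariance` at `g = c√(ρa)√s`, `V = CN` (condensation hypothesis weakened from
  `η` to `η₁, η₂ ≥ η`).

Disproof used: none exists for this crux (`ledger crux ls`, 2026-08-17). Item evidence honoured: refuter
rattack-12876 (crux restates torus BEC modulo rung 1; trivial for `τ ≥ 1`), prover 12880 diagnosis
(RewardedKyFanGap needed — it is stub 4(i) here, in the route's low-density/eventual frame rather than for all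
`N, L`, because for hard cores at high density teleport-disconnected configuration classes related by a lattice
reflection would make an all-`(N,L)` statement false).
-/

namespace Summit.AtomisticToContinuum.BoseEinsteinCondensation.Cruxes.RewardChordBound.Birth

open scoped BigOperators Topology Manifold Classical MeasureTheory ProbabilityTheory Matrix InnerProductSpace ComplexConjugate ContinuousMap
open Filter Set Function TopologicalSpace MeasureTheory

-- The measure on `ℝ/ℤ` is the Haar PROBABILITY measure, as in `PeriodicFormDomain.lean` (so that `volume` on
-- `UnitAddTorus (Fin N × Fin 3)` is definitionally the explicit product measure written in the stub signatures).
attribute [local instance] Literature.MathematicalPhysics.QuantumManyBody.BoseGas.formDomain_measureSpace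
  Literature.MathematicalPhysics.QuantumManyBody.BoseGas.formDomain_isProbabilityMeasure
  Literature.MathematicalPhysics.QuantumManyBody.BoseGas.formDomain_isProbabilityMeasure_pi


/-- **stub 1 — `RewardScaleChord` (RUNG 1, the route's own crux stmt-AtomisticToContinuum-12877, BY NAME).**
For all `τ, θ > 0`, at small density and eventually in `N`: `R(s) ≤ E₀^per + sτN` for every reward
`s ≥ θρa`. Used at `s₀ = θρa` with `τ := η/4` to START the walk. A line lead of 12877 is running its own
skeleton (picked 2026-08-17); when `RewardScaleChord_holds` lands in the route file this stub is that term.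
CLOSED 2026-08-17: item 12877 proved by `Summit.AtomisticToContinuum.BoseEinsteinCondensation.Theorems.rewardScaleChord_proof`
(module `…Theorems.BECRewardDescentRewardScaleChord`), of which this stub is now an alias.
[cite: LSSY2005 Thms 2.2/2.4; Fournais2020 Thm 1.2] -/
theorem stub_rewardScaleChord :
    Summit.AtomisticToContinuum.BoseEinsteinCondensation.Theses.BECRewardDescent.RewardScaleChord :=
  Summit.AtomisticToContinuum.BoseEinsteinCondensation.Theorems.rewardScaleChord_proof


/-- **stub 2 — `SectorGap` (the route's crux stmt-AtomisticToContinuum-12874, rank 2, BY NAME).**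
Conditional Bogoliubov `P = 0` gap: for `0 < s ≤ ρa`, IF the near-minimisers of `F_s` are
`(1−η)`-condensed THEN `F_s(Φ₁) + F_s(Φ₂) ≥ 2R(s) + c√(ρa)√s` for L²-orthogonal translation-invariant
pairs. Enters the walk through stub 6. Size: open-problem (the physics).
[cite: BoccatoEtAl2019Acta; BrenneckeCaporalettiSchlein2022; DerezinskiNapiorkowski2014] -/
theorem stub_sectorGap :
    Summit.AtomisticToContinuum.BoseEinsteinCondensation.Theses.BECRewardDescent.SectorGap := by
  sorry


/-- **stub 3 — `CondensateVariance` (the route's crux stmt-AtomisticToContinuum-12875, rank 3, BY NAME).**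
Conditional variance bound: for `0 < s ≤ ρa`, IF the near-minimisers of `F_s` are `(1−η)`-condensed THEN
every `δ`-near-minimiser has `⟨n̂₀²⟩ ≤ ⟨n̂₀⟩² + CN`. Enters the walk through stub 6. Size XL.
[cite: LiebSeiringerYngvason2005; GiorginiPitaevskiiStringari1998; BoccatoEtAl2019Acta] -/
theorem stub_condensateVariance :
    Summit.AtomisticToContinuum.BoseEinsteinCondensation.Theses.BECRewardDescent.CondensateVariance := by
  sorry



/- stub `stub_rewardedKyFanGapIntegrable` LANDED: theorem `Summit.AtomisticToContinuum.BoseEinsteinCondensation.Cruxes.RewardChordBound.Birth.stub_rewardedKyFanGapIntegrable`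
   of module Summits.AtomisticToContinuum.BoseEinsteinCondensation.Theorems.BECRewardDescentRewardChordBoundKyFanGapIntegrable (p156783), imported above and used by name in `RewardChordBound_of`. -/

/- stub `stub_rewardedZeroMomentumIntegrable` LANDED: theorem `Summit.AtomisticToContinuum.BoseEinsteinCondensation.Cruxes.RewardChordBound.Birth.stub_rewardedZeroMomentumIntegrable`
   of module Summits.AtomisticToContinuum.BoseEinsteinCondensation.Theorems.BECRewardDescentRewardChordBoundZeroMomentumIntegrable (p155153), imported above and used by name in `RewardChordBound_of`. -/

/-! ### Lead c1 reshape (2026-08-17): the hard-core Perron–Frobenius kernel `stub_rewardedSimpleNonintegrable`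
is split into five registered stubs along the seams of the tree's integrable proof and of the hard-core kit of crux
`HardCoreExtension` (`…ThirdLawCurrentFloorAlt`), with the reward's one-particle "teleport" moves replacing BOTH the
Faris–Simon log test (unavailable when `∫W = ∞`) and the hard-sphere connectivity conjecture `LemmaGConnected`:

* `stub_rewardedClassFR` — the REWARDED maximal-form ground-state class
  `𝓜_s = {η Bose-symmetric | maxFormR s v L η ≤ R(s)‖η‖²}` for a finite-range `v` (hard cores allowed): the rewarded
  max-form bound `R(s)‖ξ‖² ≤ maxFormR s v L ξ` (from the landed hard-core MaxFormApproximation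
  `stub_maxFormApproximationFiniteRange` and `L²`-Lipschitz continuity of the depletion), the Euler–Lagrange identity,
  lattice closure (`+`, `ℂ•`, `|·|`, `conj`), translation stability, closedness, and Rellich compactness of
  near-minimising (orthogonal pairs of) `C¹` states through the FREE form domain (`exists_limitProfile_of_seq`,
  `maxForm_le_of_tendsto_truncLevels`);
* `stub_teleportPackage` (lead) — for a non-negative `η` satisfying the rewarded Euler–Lagrange identity:
  (α) SATURATION on the free region `U₀ = {all nearest-image pair distances > R₀/L}`: at a.e. zero of `η` in `U₀`
  every one-particle fibre is `η`-null (test the identity against `(θ - cη)⁺`, `c → ∞`, for the pair-cut-off core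
  functions `θ`; Beurling–Deny `Kin|u| ≤ Kin u` and Cauchy–Schwarz give `limsup KinB ≤ 0`, while the reward pairing
  tends to `s ∑ᵢ ∫ (Pᵢη) θ 𝟙{η=0} ≥ 0`); (β) DESCENT: `η ≠ 0 ⇒ η ≢ 0` on `U₀` (park one non-free particle far away:
  the heredity transform `∑ᵢ gᵢ · Pᵢη` is an admissible test class positive there, and (α)-type saturation at the
  parked configurations kills the fibre through a point of `{η > 0}`), under the room condition `N·(4π/3)(R₀/L)³ < 1`;
* `stub_freeRegionSpreading` — pure measure theory on `(ℝ/ℤ)^{N×3}`: a measurable `Z` saturated along one-slot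
  translations at its points in `U₀(b)` is null or conull in `U₀(b)` once `2N·(4π/3)b³ < 1` (slot-cube saturation on
  products of well-separated boxes, cf. `cubeSaturation_c2`; slot teleport of one box by Fubini; parking chains);
* `stub_simpleOfPositiveOn` — Reed–Simon XIII.44 for an ABSTRACT lattice-closed class `M ⊆ L²` all of whose
  non-negative non-zero elements are a.e. non-zero on a set `U` of positive measure: `M ⊆ ℂη`, no two non-zero
  elements orthogonal;
* `stub_invariantApproximationFR` — the translation-invariant twin of `stub_maxFormApproximationFiniteRange`
  (clamp, pair cut-off and the invariant integrable approximation `exists_invariant_trialState_maxForm_approx` all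
  commute with the diagonal translations).
Composition (this file, lead): density `ρ < 3/(8πR₀³)` makes both room conditions hold at `L = (N/ρ)^{1/3}`;
(α)+(β)+spreading ⇒ every non-negative non-zero element of `𝓜_s` is a.e. `> 0` on `U₀`; XIII.44 ⇒ `𝓜_s ⊆ ℂη`;
compactness ⇒ (i) the strict Ky-Fan gap; `exists_invariant_mem_of_isClosed` + invariant approximation + the
depletion dictionary ⇒ (ii) invariant near-minimisers. All-(N,L) versions stay false (dense hard spheres), as before:
the room conditions are exactly where the parking geometry works. -/

/- stub `stub_rewardedClassFR` (R1) LANDED: theorem `Summit.AtomisticToContinuum.BoseEinsteinCondensation.Cruxes.RewardChordBound.Birth.stub_rewardedClassFR`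
   of module Summits.AtomisticToContinuum.BoseEinsteinCondensation.Theorems.BECRewardDescentRewardChordBoundRewardedClassFR (p162123; helpers
   …RewardedClassFRHelpers p160802), imported above and used by name in the composition. -/

/- stub `stub_teleportPackage` (R2, lead) LANDED: theorem `Summit.AtomisticToContinuum.BoseEinsteinCondensation.Cruxes.RewardChordBound.Birth.stub_teleportPackage`
   of module Summits.AtomisticToContinuum.BoseEinsteinCondensation.Theorems.BECRewardDescentRewardChordBoundTeleportDescent (helpers SlotAverage p161224,
   TeleportTest p161648, TeleportLemma p162438, TeleportSaturation p163418, TeleportDescentTools p163355, Heredity p164359 (+helpers p164045), TeleportDescent p164672),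
   imported above and used by name in the composition. -/

/- stub `stub_freeRegionSpreading` (R3) LANDED: theorem `Summit.AtomisticToContinuum.BoseEinsteinCondensation.Cruxes.RewardChordBound.Birth.stub_freeRegionSpreading`
   of module Summits.AtomisticToContinuum.BoseEinsteinCondensation.Theorems.BECRewardDescentRewardChordBoundFreeRegionSpreading (p161930; helpers
   …FreeRegionSpreadingHelpers p161591, …FreeRegionSpreadingGeometry p161602), imported above and used by name in the composition. -/

/- stub `stub_simpleOfPositiveOn` (R4) LANDED: theorem `Summit.AtomisticToContinuum.BoseEinsteinCondensation.Cruxes.RewardChordBound.Birth.stub_simpleOfPositiveOn`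
   of module Summits.AtomisticToContinuum.BoseEinsteinCondensation.Theorems.BECRewardDescentRewardChordBoundSimpleOfPositiveOn (p160160), imported above and used by name in the composition. -/

/- stub `stub_invariantApproximationFR` (R5) LANDED: theorem `Summit.AtomisticToContinuum.BoseEinsteinCondensation.Cruxes.RewardChordBound.Birth.stub_invariantApproximationFR`
   of module Summits.AtomisticToContinuum.BoseEinsteinCondensation.Theorems.BECRewardDescentRewardChordBoundInvariantApproximationFR (p162395; helpers
   …InvariantApproximationFRCutoff p160885, …InvariantApproximationFRStep p161708), imported above and used by name in the composition. -/

/- former stub `stub_rewardedSimpleNonintegrable` (4c) LANDED: theorem `Summit.AtomisticToContinuum.BoseEinsteinCondensation.Cruxes.RewardChordBound.Birth.stub_rewardedSimpleNonintegrable`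
   of module Summits.AtomisticToContinuum.BoseEinsteinCondensation.Theorems.BECRewardDescentRewardChordBoundSimpleNonintegrable (p164975; the composition of R1–R5),
   imported above and used by name in `RewardChordBound_of`. -/

/- stub `stub_noKinkOfSimple` LANDED: theorem `Summit.AtomisticToContinuum.BoseEinsteinCondensation.Cruxes.RewardChordBound.Birth.stub_noKinkOfSimple`
   of module Summits.AtomisticToContinuum.BoseEinsteinCondensation.Theorems.BECRewardDescentRewardChordBoundNoKinkOfSimple (p148632), imported above and used by name in `RewardChordBound_of`. -/

/- stub `stub_modulusOfSimple` LANDED: theorem `Summit.AtomisticToContinuum.BoseEinsteinCondensation.Cruxes.RewardChordBound.Birth.stub_modulusOfSimple`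
   of module Summits.AtomisticToContinuum.BoseEinsteinCondensation.Theorems.BECRewardDescentRewardChordBoundModulusOfSimple (p149814), imported above and used by name in `RewardChordBound_of`. -/

/- stub `stub_chordFromModulus` LANDED: theorem `Summit.AtomisticToContinuum.BoseEinsteinCondensation.Cruxes.RewardChordBound.Birth.stub_chordFromModulus`
   of module Summits.AtomisticToContinuum.BoseEinsteinCondensation.Theorems.BECRewardDescentRewardChordBoundChordFromModulus (p149472), imported above and used by name in `RewardChordBound_of`. -/

/-- **Assembly / skeleton theorem.** `RewardChordBound` (the route decl, BY NAME) from the seven declared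
stubs used BY NAME — the quantifier plumbing of the walk, no `sorry` of its own: `η := min η₁ η₂` (stubs
2/3), `θ := θ(η, c, C, τ)` (stub 7), `ρ₀ := min ρ₁ ρ₂ ρ₃ ρ₄ ρ₅` (stubs 2, 3, 1, `PeriodicEnergyFinite_holds`,
stubs 4a–4c by cases on `∫ v < ∞`), intersection of the five eventual sets, finiteness of every `R(t)` from `E₀ < ∞`, then stub 7 ← rung 1
at `s₀` (guarded by `0 < s₀`), stub 5 ← stub 4(i), stub 6 ← stub 4(ii) on `[s−h, s+h] ⊂ (0,∞)`, `SectorGap`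
and `CondensateVariance` at `g = c√(ρa)√s`, `V = CN` with the condensation hypothesis weakened from `η` to
`η₁, η₂ ≥ η`. -/
theorem RewardChordBound_of :
    Summit.AtomisticToContinuum.BoseEinsteinCondensation.Theses.BECRewardDescent.RewardChordBound := by
  have hRS := stub_rewardScaleChord
  have hGap := stub_sectorGap
  have hVar := stub_condensateVariance
  have hKF := stub_rewardedKyFanGapIntegrable
  have hZM := stub_rewardedZeroMomentumIntegrable
  have hNI := stub_rewardedSimpleNonintegrable
  have hKink := stub_noKinkOfSimple
  have hMod := stub_modulusOfSimple
  have hW2 := stub_chordFromModulus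
  intro v hv τ hτ
  obtain ⟨η₁, c, ρ₁, hη₁, hc, hρ₁, hG⟩ := hGap v hv
  obtain ⟨η₂, C, ρ₂, hη₂, hC, hρ₂, hV⟩ := hVar v hv
  obtain ⟨θ, hθ, hθ1, hW⟩ := hW2 v (min η₁ η₂) c C τ (lt_min hη₁ hη₂) hc hC hτ
  obtain ⟨ρ₃, hρ₃, hR1⟩ := hRS v hv (min η₁ η₂ / 4) θ (by positivity) hθ
  obtain ⟨ρ₄, hρ₄, hFin⟩ :=
    Summit.AtomisticToContinuum.BoseEinsteinCondensation.Theses.BECRewardDescent.PeriodicEnergyFinite_holds v hv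
  -- the Perron–Frobenius input, by cases on integrability of the pair profile
  have hSimple : ∃ ρ₅ : ℝ, 0 < ρ₅ ∧ ∀ ρ : ℝ, 0 < ρ → ρ < ρ₅ → ∀ᶠ N : ℕ in Filter.atTop, ∀ s : ℝ, 0 < s →
      (⨅ Ψ : Literature.MathematicalPhysics.QuantumManyBody.BoseGas.PeriodicTrialState N (Literature.MathematicalPhysics.QuantumManyBody.BoseGas.sideLength ρ N), (Literature.MathematicalPhysics.QuantumManyBody.BoseGas.periodicEnergy v Ψ + ENNReal.ofReal s * ((N : ENNReal) - Literature.MathematicalPhysics.QuantumManyBody.BoseGas.condensateOccupation N (Literature.MathematicalPhysics.QuantumManyBody.BoseGas.sideLength ρ N) Ψ.ψ))) ≠ ⊤ →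
      (∃ g : ℝ, 0 < g ∧ (∀ Φ₁ Φ₂ : Literature.MathematicalPhysics.QuantumManyBody.BoseGas.PeriodicTrialState N (Literature.MathematicalPhysics.QuantumManyBody.BoseGas.sideLength ρ N), (∫ X in Literature.MathematicalPhysics.QuantumManyBody.BoseGas.cellN N (Literature.MathematicalPhysics.QuantumManyBody.BoseGas.sideLength ρ N), starRingEnd ℂ (Φ₁.ψ X) * Φ₂.ψ X) = 0 → 2 * (⨅ Ψ : Literature.MathematicalPhysics.QuantumManyBody.BoseGas.PeriodicTrialState N (Literature.MathematicalPhysics.QuantumManyBody.BoseGas.sideLength ρ N), (Literature.MathematicalPhysics.QuantumManyBody.BoseGas.periodicEnergy v Ψ + ENNReal.ofReal s * ((N : ENNReal) - Literature.MathematicalPhysics.QuantumManyBody.BoseGas.condensateOccupation N (Literature.MathematicalPhysics.QuantumManyBody.BoseGas.sideLength ρ N) Ψ.ψ))) + ENNReal.ofReal g ≤ (Literature.MathematicalPhysics.QuantumManyBody.BoseGas.periodicEnergy v Φ₁ + ENNReal.ofReal s * ((N : ENNReal) - Literature.MathematicalPhysics.QuantumManyBody.BoseGas.condensateOccupation N (Literature.MathematicalPhysics.QuantumManyBody.BoseGas.sideLength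 ρ N) Φ₁.ψ)) + (Literature.MathematicalPhysics.QuantumManyBody.BoseGas.periodicEnergy v Φ₂ + ENNReal.ofReal s * ((N : ENNReal) - Literature.MathematicalPhysics.QuantumManyBody.BoseGas.condensateOccupation N (Literature.MathematicalPhysics.QuantumManyBody.BoseGas.sideLength ρ N) Φ₂.ψ)))) ∧ (∀ δ : ENNReal, 0 < δ → ∃ Ψ : Literature.MathematicalPhysics.QuantumManyBody.BoseGas.PeriodicTrialState N (Literature.MathematicalPhysics.QuantumManyBody.BoseGas.sideLength ρ N), (∀ (X : Literature.MathematicalPhysics.QuantumManyBody.BoseGas.Config N) (t : EuclideanSpace ℝ (Fin 3)), Ψ.ψ (fun i => X i + t) = Ψ.ψ X) ∧ (Literature.MathematicalPhysics.QuantumManyBody.BoseGas.periodicEnergy v Ψ + ENNReal.ofReal s * ((N : ENNReal) - Literature.MathematicalPhysics.QuantumManyBody.BoseGas.condensateOccupation N (Literature.MathematicalPhysics.QuantumManyBody.BoseGas.sideLength ρ N) Ψ.ψ)) ≤ (⨅ Ψ : Literature.MathematicalPhysics.QuantumManyBody.BoseGas.PeriodicTrialState N (Literature.MathematicalPhysics.QuantumManyBody.BoseGas.sideLength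 ρ N), (Literature.MathematicalPhysics.QuantumManyBody.BoseGas.periodicEnergy v Ψ + ENNReal.ofReal s * ((N : ENNReal) - Literature.MathematicalPhysics.QuantumManyBody.BoseGas.condensateOccupation N (Literature.MathematicalPhysics.QuantumManyBody.BoseGas.sideLength ρ N) Ψ.ψ))) + δ) := by
    by_cases hint : (∫⁻ x : Literature.MathematicalPhysics.QuantumManyBody.BoseGas.Space, v ‖x‖) = ⊤
    · exact hNI v hv hint
    · refine ⟨1, one_pos, fun ρ hρ _ => ?_⟩
      filter_upwards [Filter.eventually_ge_atTop 1] with N hN s hs hRs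
      have hL : 0 < Literature.MathematicalPhysics.QuantumManyBody.BoseGas.sideLength ρ N :=
        Real.rpow_pos_of_pos (div_pos (Nat.cast_pos.2 hN) hρ) _
      exact ⟨hKF v hv hint N _ s hN hL hs hRs, hZM v hv hint N _ s hN hL hs hRs⟩
  obtain ⟨ρ₅, hρ₅, hS⟩ := hSimple
  refine ⟨θ, min ρ₁ (min ρ₂ (min ρ₃ (min ρ₄ ρ₅))), hθ,
    lt_min hρ₁ (lt_min hρ₂ (lt_min hρ₃ (lt_min hρ₄ hρ₅))), fun ρ hρ hρlt => ?_⟩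
  have h1 : ρ < ρ₁ := lt_of_lt_of_le hρlt (min_le_left _ _)
  have h2 : ρ < ρ₂ := lt_of_lt_of_le hρlt ((min_le_right _ _).trans (min_le_left _ _))
  have h3 : ρ < ρ₃ :=
    lt_of_lt_of_le hρlt ((min_le_right _ _).trans ((min_le_right _ _).trans (min_le_left _ _)))
  have h4 : ρ < ρ₄ := lt_of_lt_of_le hρlt
    ((min_le_right _ _).trans ((min_le_right _ _).trans ((min_le_right _ _).trans (min_le_left _ _))))
  have h5 : ρ < ρ₅ := lt_of_lt_of_le hρlt
    ((min_le_right _ _).trans ((min_le_right _ _).trans ((min_le_right _ _).trans (min_le_right _ _))))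
  have hN0 : ∀ N : ℕ, (0 : ℝ) ≤ N := fun N => N.cast_nonneg
  have hη₁' : ∀ N : ℕ, (1 - η₁) * (N : ℝ) ≤ (1 - min η₁ η₂) * N := fun N =>
    mul_le_mul_of_nonneg_right (by linarith [min_le_left η₁ η₂]) (hN0 N)
  have hη₂' : ∀ N : ℕ, (1 - η₂) * (N : ℝ) ≤ (1 - min η₁ η₂) * N := fun N =>
    mul_le_mul_of_nonneg_right (by linarith [min_le_right η₁ η₂]) (hN0 N)
  filter_upwards [hG ρ hρ h1, hV ρ hρ h2, hR1 ρ hρ h3, hFin ρ hρ h4, hS ρ hρ h5] with N hGN hVN hRN hFN hSN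
  -- every `R(t)` is finite: `R(t) ≤ E(Ψ) + tN` for a finite-energy `Ψ`
  have hRt : ∀ t : ℝ, (⨅ Ψ : Literature.MathematicalPhysics.QuantumManyBody.BoseGas.PeriodicTrialState N (Literature.MathematicalPhysics.QuantumManyBody.BoseGas.sideLength ρ N), (Literature.MathematicalPhysics.QuantumManyBody.BoseGas.periodicEnergy v Ψ + ENNReal.ofReal t * ((N : ENNReal) - Literature.MathematicalPhysics.QuantumManyBody.BoseGas.condensateOccupation N (Literature.MathematicalPhysics.QuantumManyBody.BoseGas.sideLength ρ N) Ψ.ψ))) ≠ ⊤ := fun t =>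
    Summit.AtomisticToContinuum.BoseEinsteinCondensation.Theorems.WalkGlue.iInf_affine_ne_top
      (fun Ψ : Literature.MathematicalPhysics.QuantumManyBody.BoseGas.PeriodicTrialState N (Literature.MathematicalPhysics.QuantumManyBody.BoseGas.sideLength ρ N) => Literature.MathematicalPhysics.QuantumManyBody.BoseGas.periodicEnergy v Ψ)
      (fun Ψ : Literature.MathematicalPhysics.QuantumManyBody.BoseGas.PeriodicTrialState N (Literature.MathematicalPhysics.QuantumManyBody.BoseGas.sideLength ρ N) => ((N : ENNReal) - Literature.MathematicalPhysics.QuantumManyBody.BoseGas.condensateOccupation N (Literature.MathematicalPhysics.QuantumManyBody.BoseGas.sideLength ρ N) Ψ.ψ))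
      (M := (N : ENNReal)) (fun Ψ => tsub_le_self) (ENNReal.natCast_ne_top N) hFN t
  refine hW ρ N hFN (fun hpos => hRN _ hpos le_rfl) ?_ ?_
  · intro s hs ε hε
    exact hKink v hv N _ s hs (hRt s) (hSN s hs (hRt s)).1 ε hε
  · intro s h hh hhs hsa hlt hcond
    have hs : 0 < s := hh.trans hhs
    have hg : 0 < c * Real.sqrt (ρ * (Literature.MathematicalPhysics.QuantumManyBody.BoseGas.scatteringLength v).toReal) * Real.sqrt s :=
      lt_of_le_of_lt (by positivity) hlt
    obtain ⟨δ, hδ, hΨ⟩ := hcond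
    refine hMod v hv N _ s h (c * Real.sqrt (ρ * (Literature.MathematicalPhysics.QuantumManyBody.BoseGas.scatteringLength v).toReal) * Real.sqrt s) (C * N) hh hhs hg hlt (hRt s) ?_ ?_ ?_
    · intro t ht₁ ht₂ δ' hδ'
      have ht : 0 < t := by linarith
      exact (hSN t ht (hRt t)).2 δ' hδ'
    · intro Φ₁ Φ₂ hΦ₁ hΦ₂ horth
      exact hGN s hs hsa ⟨δ, hδ, fun Ψ hF => (ENNReal.ofReal_le_ofReal (hη₁' N)).trans (hΨ Ψ hF)⟩
        Φ₁ Φ₂ hΦ₁ hΦ₂ horth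
    · exact hVN s hs hsa ⟨δ, hδ, fun Ψ hF => (ENNReal.ofReal_le_ofReal (hη₂' N)).trans (hΨ Ψ hF)⟩

end Summit.AtomisticToContinuum.BoseEinsteinCondensation.Cruxes.RewardChordBound.Birth

/-!
## Lead c2 reshape (2026-08-17): a SECOND, independent composition — the strategist's line `dyadic-secant`

The `Birth` composition above is sorry-free except for the two EXTERNAL stubs `stub_sectorGap` (item 12874) and
`stub_condensateVariance` (item 12875). The crux strategist (`cstrat-stmt-AtomisticToContinuum-12876-s1`) registered beside
it the alternative line `Lines/dyadic_secant.lean`: `RewardChordBound ⇐ stub_shellModulus ∧ stub_secantWalk`, where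
`stub_secantWalk` is pure real analysis (provable now) and `stub_shellModulus` is a one-shell three-energy inequality
(the physics, re-cut: no gap, no variance, no simplicity, no derivative). Lead c2 carries BOTH compositions in the
registered skeleton so that all four stubs are registered on the item: the crux closes as soon as EITHER
{`stub_sectorGap`, `stub_condensateVariance`} OR {`stub_shellModulus`, `stub_secantWalk`} is sorry-free. The section below
is the strategist's file verbatim (namespace `…Cruxes.RewardChordBound.DyadicSecant`, its own `RewardChordBound_of`).

State after lead c2, cycle 1 (2026-08-17): `stub_secantWalk` LANDED (p172665, real-analysis core p172292); the reduction
`RewardChordBound ⇐ ShellModulus` LANDED as `DyadicSecant.rewardChordBound_of_shellModulus`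
(`Theorems/BECRewardDescentRewardChordBoundShellReduction.lean`, p172950); and the ORDERING of the two open inputs,
`SectorGap ∧ CondensateVariance ⇒ ShellModulus` (`DyadicSecant.shellModulus_of_sectorGap_of_condensateVariance`,
`Theorems/BECRewardDescentRewardChordBoundShellOfGapVar.lean` + `…ShellOfModulus.lean`), so the crux now reads
`SectorGap ∧ CondensateVariance ⇒ ShellModulus ⇒ RewardChordBound`, kernel-checked: three open stubs remain, all
thermodynamic-limit physics (`stub_sectorGap` = item 12874, `stub_condensateVariance` = item 12875, `stub_shellModulus`).
-/

namespace Summit.AtomisticToContinuum.BoseEinsteinCondensation.Cruxes.RewardChordBound.DyadicSecant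

open scoped BigOperators Topology Classical ENNReal
open Filter Set

/-- **stub 1 — `ShellModulus` (OPEN; the one-shell estimate of the reward RG).** For every repulsive finite-range
`v` there are `η, K, ρ₀ > 0` and a shell ceiling `σ ∈ (0, 1]` such that for `0 < ρ < ρ₀`, eventually in `N`, for every
reward shell `(u, 4u]` with `4u ≤ σρa`: if at every reward `w ∈ (2u, 4u]` the near-minimisers of
`F_w = ⟨·,H·⟩ + w(N − n̂₀)` (at some precision `δ > 0`) are `(1−η)`-condensed, then `3R(2u) ≤ 2R(u) + R(4u) + K N u √(u/(ρa))` for the reward infimum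
`R(t) = inf_Ψ F_t(Ψ)` on the periodic box of side `(N/ρ)^{1/3}`. Three rewarded (gapped) ground-state energies per
shell; no gap, variance, simplicity or derivative enters. Why it might fail: at shells `u → 0⁺` (with `N → ∞` first)
it forbids fragmented competitors with `≳ N√(u/ρa)` extra depleted particles within rewarded energy `O(Nu^{3/2}/√(ρa))`
of optimal — the infrared content of torus BEC, in one-shell form. [cite: LSSY2005, Ch. 5 §5.1 and App. D]
[cite: Griffiths1966] [cite: LiebSeiringerYngvason2005] -/
theorem stub_shellModulus :
    ∀ v : ℝ → ENNReal, Literature.MathematicalPhysics.QuantumManyBody.BoseGas.IsRepulsiveFiniteRange v →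
      ∃ η K σ ρ₀ : ℝ, 0 < η ∧ 0 < K ∧ 0 < σ ∧ σ ≤ 1 ∧ 0 < ρ₀ ∧ ∀ ρ : ℝ, 0 < ρ → ρ < ρ₀ → ∀ᶠ N : ℕ in Filter.atTop,
        ∀ u : ℝ, 0 < u → 4 * u ≤ σ * ρ * (Literature.MathematicalPhysics.QuantumManyBody.BoseGas.scatteringLength v).toReal →
          (∀ w : ℝ, 2 * u < w → w ≤ 4 * u → ∃ δ : ENNReal, 0 < δ ∧
            ∀ Ψ : Literature.MathematicalPhysics.QuantumManyBody.BoseGas.PeriodicTrialState N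
              (Literature.MathematicalPhysics.QuantumManyBody.BoseGas.sideLength ρ N),
              Literature.MathematicalPhysics.QuantumManyBody.BoseGas.periodicEnergy v Ψ + ENNReal.ofReal w *
                  ((N : ENNReal) - Literature.MathematicalPhysics.QuantumManyBody.BoseGas.condensateOccupation N
                    (Literature.MathematicalPhysics.QuantumManyBody.BoseGas.sideLength ρ N) Ψ.ψ) ≤
                (⨅ Ψ' : Literature.MathematicalPhysics.QuantumManyBody.BoseGas.PeriodicTrialState N
                  (Literature.MathematicalPhysics.QuantumManyBody.BoseGas.sideLength ρ N),
                  (Literature.MathematicalPhysics.QuantumManyBody.BoseGas.periodicEnergy v Ψ' + ENNReal.ofReal w *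
                    ((N : ENNReal) - Literature.MathematicalPhysics.QuantumManyBody.BoseGas.condensateOccupation N
                      (Literature.MathematicalPhysics.QuantumManyBody.BoseGas.sideLength ρ N) Ψ'.ψ))) + δ →
              ENNReal.ofReal ((1 - η) * N) ≤
                Literature.MathematicalPhysics.QuantumManyBody.BoseGas.condensateOccupation N
                  (Literature.MathematicalPhysics.QuantumManyBody.BoseGas.sideLength ρ N) Ψ.ψ) →
          3 * (⨅ Ψ : Literature.MathematicalPhysics.QuantumManyBody.BoseGas.PeriodicTrialState N
              (Literature.MathematicalPhysics.QuantumManyBody.BoseGas.sideLength ρ N),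
              (Literature.MathematicalPhysics.QuantumManyBody.BoseGas.periodicEnergy v Ψ + ENNReal.ofReal (2 * u) *
                ((N : ENNReal) - Literature.MathematicalPhysics.QuantumManyBody.BoseGas.condensateOccupation N
                  (Literature.MathematicalPhysics.QuantumManyBody.BoseGas.sideLength ρ N) Ψ.ψ))) ≤
            2 * (⨅ Ψ : Literature.MathematicalPhysics.QuantumManyBody.BoseGas.PeriodicTrialState N
                (Literature.MathematicalPhysics.QuantumManyBody.BoseGas.sideLength ρ N),
                (Literature.MathematicalPhysics.QuantumManyBody.BoseGas.periodicEnergy v Ψ + ENNReal.ofReal u *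
                  ((N : ENNReal) - Literature.MathematicalPhysics.QuantumManyBody.BoseGas.condensateOccupation N
                    (Literature.MathematicalPhysics.QuantumManyBody.BoseGas.sideLength ρ N) Ψ.ψ))) +
              (⨅ Ψ : Literature.MathematicalPhysics.QuantumManyBody.BoseGas.PeriodicTrialState N
                (Literature.MathematicalPhysics.QuantumManyBody.BoseGas.sideLength ρ N),
                (Literature.MathematicalPhysics.QuantumManyBody.BoseGas.periodicEnergy v Ψ + ENNReal.ofReal (4 * u) *
                  ((N : ENNReal) - Literature.MathematicalPhysics.QuantumManyBody.BoseGas.condensateOccupation N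
                    (Literature.MathematicalPhysics.QuantumManyBody.BoseGas.sideLength ρ N) Ψ.ψ))) +
              ENNReal.ofReal (K * N * u * Real.sqrt (u / (ρ *
                (Literature.MathematicalPhysics.QuantumManyBody.BoseGas.scatteringLength v).toReal))) := by
  sorry

/- stub `stub_secantWalk` LANDED (lead c2, 2026-08-17): theorem
   `Summit.AtomisticToContinuum.BoseEinsteinCondensation.Cruxes.RewardChordBound.DyadicSecant.stub_secantWalk` of module
   Summits.AtomisticToContinuum.BoseEinsteinCondensation.Theorems.BECRewardDescentRewardChordBoundSecantWalk (p172665; real-analysis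
   core …SecantWalkReal p172292), imported above and used by name in `DyadicSecant.RewardChordBound_of`. -/

open Literature.MathematicalPhysics.QuantumManyBody.BoseGas in
/-- **Composition.** `RewardChordBound` (the route decl, BY NAME) from the two stubs BY NAME and the route's proved
items `RewardScaleChord` (`Theorems.rewardScaleChord_proof`, item 12877) and `PeriodicEnergyFinite`
(`PeriodicEnergyFinite_holds`); no `sorry` of its own. -/
theorem RewardChordBound_of :
    Summit.AtomisticToContinuum.BoseEinsteinCondensation.Theses.BECRewardDescent.RewardChordBound := by
  intro v hv τ hτ
  obtain ⟨η, K, σ, ρ₁, hη, hK, hσ, hσ1, hρ₁, hS⟩ := stub_shellModulus v hv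
  obtain ⟨θ, hθ, hθ4, hW⟩ := stub_secantWalk η K τ σ hη hK hτ hσ hσ1
  obtain ⟨ρ₃, hρ₃, hR1⟩ :=
    Summit.AtomisticToContinuum.BoseEinsteinCondensation.Theorems.rewardScaleChord_proof v hv (η / 4) θ
      (by positivity) hθ
  obtain ⟨ρ₄, hρ₄, hFin⟩ :=
    Summit.AtomisticToContinuum.BoseEinsteinCondensation.Theses.BECRewardDescent.PeriodicEnergyFinite_holds v hv
  refine ⟨θ, min ρ₁ (min ρ₃ ρ₄), hθ, lt_min hρ₁ (lt_min hρ₃ hρ₄), fun ρ hρ hρlt => ?_⟩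
  have h1 : ρ < ρ₁ := lt_of_lt_of_le hρlt (min_le_left _ _)
  have h3 : ρ < ρ₃ := lt_of_lt_of_le hρlt ((min_le_right _ _).trans (min_le_left _ _))
  have h4 : ρ < ρ₄ := lt_of_lt_of_le hρlt ((min_le_right _ _).trans (min_le_right _ _))
  filter_upwards [hS ρ hρ h1, hR1 ρ hρ h3, hFin ρ hρ h4] with N hSN hRN hFN
  intro s hs hsle
  exact hW (PeriodicTrialState N (sideLength ρ N)) (fun Ψ => periodicEnergy v Ψ)
    (fun Ψ => (N : ℝ≥0∞) - condensateOccupation N (sideLength ρ N) Ψ.ψ)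
    (fun Ψ => ENNReal.ofReal ((1 - η) * N) ≤ condensateOccupation N (sideLength ρ N) Ψ.ψ)
    (fun t => ⨅ Ψ : PeriodicTrialState N (sideLength ρ N), (periodicEnergy v Ψ +
      ENNReal.ofReal t * ((N : ℝ≥0∞) - condensateOccupation N (sideLength ρ N) Ψ.ψ)))
    N ρ _ (fun _ => rfl) (fun _ => tsub_le_self) hFN
    (fun Ψ h =>
      Summit.AtomisticToContinuum.BoseEinsteinCondensation.Cruxes.RewardChordBound.Birth.ChordFromModulus.condensed_of_depletion_lt
        hη.le h)
    (fun hpos => hRN _ hpos le_rfl) (fun u hu h4u hcond => hSN u hu h4u hcond) s hs hsle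

end Summit.AtomisticToContinuum.BoseEinsteinCondensation.Cruxes.RewardChordBound.DyadicSecant
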